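import Summits.HodgeConjecture.HodgeConjecture.Theorems.F0P6aOrganB2SiegelAdmissible    -- ★ p850979 (LA4-p02 (g2)) `organB2_holds` (DEAL #45; frame v2 §2b body verbatim)
import Summits.HodgeConjecture.HodgeConjecture.Theorems.F0P6aStubESHEETGlobalGlueDefs    -- ★ p851004 (LA7-p01 (g4)) the (T) statement layer: `def OrganB2`
import HarnessLib

/-!
# ORGAN (B2) AT THE NAME OF RECORD: `organB2 : F0P6aStubESHEETGlobalGlue.OrganB2` (junction of ★ p850979 with LA7-p01 (g4)՚s ★ statement layer p851004)

Cell `hodgecm-mathlib` (D-0151), FLOOR 0, P6 «MOD programme», crux hLiu418 (stmt-HodgeConjecture-24832, `--supports … --as helper`, count-neutral), line «L4», (S8)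
closer `Lines/F0_P6a_StubESHEET.lean` ED. 2 socket `hole_SHEET_global`, LEG-E(γ′) glue head `organSHEETGlobal_of_organs : (B1) → (B2) → (B3) → OrganSHEETGlobal`
(LA7-p01 (g4), ★ `Theorems/F0P6aStubESHEETGlobalGlue{Defs,}.lean`).  THIS FILE: the organ (B2) UNDER THE DEF OF RECORD — `theorem organB2 : OrganB2 := organB2_holds`
(the def body of ★ p851004 and the theorem type of ★ p850979 are the same text, frame v2 0296e401 §2b; the kernel confirms it here), so the glue binds ONE name.
HONEST LABEL: HC_CM is proved only modulo the 7 printed citations (2 remaining: hLiu418 = stmt-HodgeConjecture-24832, h413 = stmt-HodgeConjecture-24833) until rung 0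
closes; this file is count-neutral. [cite: Milne2005ShimuraVarieties, §6 Thm. 6.11 pp. 74–75] [cite: Shimura1998, §18.6 Thm. 18.6 pp. 124–125]
-/

set_option autoImplicit false

namespace Summit.HodgeConjecture.HodgeConjecture.Theorems.F0P6aOrganB2

set_option linter.dupNamespace false  -- `Summit.HodgeConjecture.HodgeConjecture.…` BY DESIGN (D-0017)

/-- **ORGAN (B2) PAID at the name of record** — `F0P6aStubESHEETGlobalGlue.OrganB2` (LA7-p01 (g4)՚s ★ statement layer) IS `organB2_holds` (★ p850979): the
classifying slice `ε₂` of the twisted tuple `T_𝔞` reads the twisted point map `f₂` on the complex points of the `τE`-sheet.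
[cite: Milne2005ShimuraVarieties, §6 Thm. 6.11 pp. 74–75; §14 pp. 124–125] [cite: Shimura1998, §18.6 Thm. 18.6 pp. 124–125]
[cite: MumfordFogartyKirwan1994, Ch. 7 §2 Def. 7.2–7.3 (p. 129), §3 Thm. 7.9 (p. 139)] -/
theorem organB2 : Summit.HodgeConjecture.HodgeConjecture.Theorems.F0P6aStubESHEETGlobalGlue.OrganB2 :=
  Summit.HodgeConjecture.HodgeConjecture.Theorems.F0P6aOrganB2SiegelAdmissible.organB2_holds

end Summit.HodgeConjecture.HodgeConjecture.Theorems.F0P6aOrganB2
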